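import Mathlib
import HarnessLib
import Summits.HubbardSuperconductivity.HubbardSuperconductivity.Theorems.KLProgrammeKLRegimeTwoVolumeSourceSmoothDefs
import Summits.HubbardSuperconductivity.HubbardSuperconductivity.Theorems.KLProgrammeKLRegimeTwoVolumeTowerSrcScaledKit

/-!
# Route `KLProgramme` — crux K3, VL child (stmt-HubbardSuperconductivity-20440), keying option «(VL)-SRC-WINDOW»: THE SOURCE SMOOTHING COMMUTES WITH
# THE TOWER'S SPINE (dead-variable covariance steps, source truncation, doubled transfers) (seat hubbard-kl-k3c4-p1 g16, filed by g17 under the pen's (R235) «KEY = WINDOW»)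

The analogue for `srcSmooth` (`…TwoVolumeSourceSmoothDefs`) of the g15 commutation kit for `srcScale` (`…TowerSrcScaledKit`):
* §3 `mul_srcSmoothMat_eq` / **`srcSmoothMat_transpose_mul_mul_eq`** (`Sᵀ·C·S = C` for every covariance vanishing on copy `1`) ⇒ **`effAction_srcSmooth_comm`**
  (Literature `effAction_map`) and `srcTrunc_srcSmooth_srcTrunc` (`srcTrunc_map_srcTrunc`);
* §4 **`srcSmoothMat_mul_klSrcTransfer`** (`S_{k+1}·T⁺_k = T⁺_k·S_k`: the re-analysis acts on the alive copy where `S = 𝟙`, the slot shift is diagonal in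
  space-time/spin/charge while the smoothing is diagonal in site/slot/spin/charge and acts on time only) ⇒ **`map_klSrcTransfer_srcSmooth_comm`**.

Proofs only; finite matrix algebra; nothing about the Hubbard model is asserted.  [cite: Salmhofer1999, App. B.2 (B.23)-(B.25)]
-/

noncomputable section

namespace Summit.HubbardSuperconductivity.HubbardSuperconductivity.Theorems.TwoVolumeSource

set_option linter.dupNamespace false -- summit = problem name (single-conjunct summit), D-0017

open Finset Complex Literature.MathematicalPhysics.QuantumLattice Literature.Probability.LatticeModels
open scoped Real

/-! ## §3 Commutation: covariance steps vanishing on the sources, source truncation -/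

section Commute

open GrassmannAlgebra

variable {V M n : ℕ} [NeZero V]

omit [NeZero V] in
/-- In `Fin 2`, `s ≠ 0 ⇒ s = 1`. [folklore] -/
theorem fin_two_eq_one_of_ne_zero {s : Fin 2} (h : ¬ s = 0) : s = 1 := by
  rcases Fin.exists_fin_two.mp ⟨s, rfl⟩ with h0 | h1
  · exact absurd h0 h
  · exact h1

omit [NeZero V] in
/-- `S a X = [a = X]` whenever `a` is alive (copy `0`). -/
theorem srcSmoothMat_apply_of_alive (a X : SrcLabel V M n) (ha : a.2 = 0) : srcSmoothMat V M n a X = if a = X then 1 else 0 := by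
  rw [srcSmoothMat_apply]
  by_cases hX : X.2 = 0
  · rw [if_pos ⟨ha, hX⟩]
    by_cases h : a = X
    · rw [if_pos h, if_pos (congrArg Prod.fst h)]
    · have h1 : a.1 ≠ X.1 := fun h1 => h (Prod.ext h1 (ha.trans hX.symm))
      rw [if_neg h1, if_neg h]
  · have h01 : ¬(a.2 = 0 ∧ X.2 = 0) := fun h => hX h.2
    have h11 : ¬(a.2 = 1 ∧ X.2 = 1) := fun h => absurd (ha.symm.trans h.1) (by decide)
    have hne : a ≠ X := fun h => hX (h ▸ ha)
    rw [if_neg h01, if_neg h11, if_neg hne]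

/-- **Right identity**: `C * S = C` for a covariance vanishing on the sources. [cite: Salmhofer1999, App. B.2 (B.23)-(B.25)] -/
theorem mul_srcSmoothMat_eq (C : Matrix (SrcLabel V M n) (SrcLabel V M n) ℂ) (hC : ∀ X Y : SrcLabel V M n, X.2 = 1 ∨ Y.2 = 1 → C X Y = 0) :
    C * srcSmoothMat V M n = C := by
  classical
  ext a Y
  rw [Matrix.mul_apply]
  by_cases hY : Y.2 = 0
  · rw [Finset.sum_eq_single Y]
    · rw [srcSmoothMat_apply_of_alive Y Y hY, if_pos rfl, mul_one]
    · intro b _ hbY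
      by_cases hb : b.2 = 0
      · rw [srcSmoothMat_apply_of_alive b Y hb, if_neg hbY, mul_zero]
      · rw [hC a b (Or.inr (fin_two_eq_one_of_ne_zero hb)), zero_mul]
    · intro h; exact absurd (Finset.mem_univ Y) h
  · have hY1 : Y.2 = 1 := fin_two_eq_one_of_ne_zero hY
    rw [hC a Y (Or.inr hY1)]
    refine Finset.sum_eq_zero fun b _ => ?_
    by_cases hb : b.2 = 0
    · have hbY : b ≠ Y := fun h => hY (h ▸ hb)
      rw [srcSmoothMat_apply_of_alive b Y hb, if_neg hbY, mul_zero]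
    · rw [hC a b (Or.inr (fin_two_eq_one_of_ne_zero hb)), zero_mul]

/-- **Pull-back of a covariance vanishing on the sources along the smoothing is the covariance itself** (the smoothing is the identity on the alive
copy and copy-diagonal). [cite: Salmhofer1999, App. B.2 (B.23)-(B.25)] -/
theorem srcSmoothMat_transpose_mul_mul_eq (C : Matrix (SrcLabel V M n) (SrcLabel V M n) ℂ)
    (hC : ∀ X Y : SrcLabel V M n, X.2 = 1 ∨ Y.2 = 1 → C X Y = 0) :
    (srcSmoothMat V M n).transpose * C * srcSmoothMat V M n = C := by
  have hCt : ∀ X Y : SrcLabel V M n, X.2 = 1 ∨ Y.2 = 1 → C.transpose X Y = 0 := fun X Y h => by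
    rw [Matrix.transpose_apply]; exact hC Y X h.symm
  have h1 : (srcSmoothMat V M n).transpose * C = C := by
    rw [← Matrix.transpose_transpose C, ← Matrix.transpose_mul, mul_srcSmoothMat_eq C.transpose hCt]
  rw [h1, mul_srcSmoothMat_eq C hC]

/-- **The step of a covariance vanishing on the sources commutes with the smoothing** (dead variables; cf. `effAction_srcScale_comm`).
[cite: Salmhofer1999, App. B.2 (B.23)-(B.25)] -/
theorem effAction_srcSmooth_comm (C : Matrix (SrcLabel V M n) (SrcLabel V M n) ℂ) (hC : ∀ X Y : SrcLabel V M n, X.2 = 1 ∨ Y.2 = 1 → C X Y = 0)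
    (F : GrassmannAlgebra ℂ (SrcLabel V M n)) :
    effAction ℂ C (srcSmooth V M n F) = srcSmooth V M n (effAction ℂ C F) := by
  rw [srcSmooth_apply, srcSmooth_apply, effAction_map, LinearMap.toMatrix'_toLin', srcSmoothMat_transpose_mul_mul_eq C hC]

/-- **Source truncation may be run before the smoothing**: `srcTrunc k (srcSmooth (srcTrunc k F)) = srcTrunc k (srcSmooth F)` (the smoothing sends sources to
sources). [cite: BenfattoGiulianiMastropietro2006, §2.9 (4.3)-(4.6)] -/
theorem srcTrunc_srcSmooth_srcTrunc (k : ℕ) (F : GrassmannAlgebra ℂ (SrcLabel V M n)) :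
    srcTrunc ℂ (fun Y : SrcLabel V M n => Y.2 = 1) k (srcSmooth V M n (srcTrunc ℂ (fun Y : SrcLabel V M n => Y.2 = 1) k F)) =
      srcTrunc ℂ (fun Y : SrcLabel V M n => Y.2 = 1) k (srcSmooth V M n F) := by
  rw [srcSmooth_apply, srcSmooth_apply]
  refine srcTrunc_map_srcTrunc ℂ (fun Y : SrcLabel V M n => Y.2 = 1) (fun Y : SrcLabel V M n => Y.2 = 1) _ (fun X X' hX hX' => ?_) k F
  rw [LinearMap.toMatrix'_toLin']
  obtain ⟨x, s⟩ := X
  obtain ⟨x', s'⟩ := X'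
  exact srcSmoothMat_offDiag V M n x' s' x s (fun h => hX' (h.trans hX))

end Commute


/-! ## §4 Commutation with the doubled transfers (`klReanalysis ⊕ klSlotShift`) -/

section Transfer

open GrassmannAlgebra

variable {V M : ℕ} [NeZero V]

/-- The common closed form of both products `S_{k+1}·T⁺_k` and `T⁺_k·S_k`. -/
def transferSmoothForm (β μ : ℝ) (K : TrigPolyC4v) (k : ℕ) (p' : SrcLabel V M (k + 1)) (p : SrcLabel V M k) : ℂ :=
  if p'.2 = 0 ∧ p.2 = 0 then klReanalysis V M β μ K k p'.1 p.1
  else if p'.2 = 1 ∧ p.2 = 1 then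
    (if p'.1.1.2 = p.1.1.2 ∧ ((p'.1.2.1.1 : ℕ) = 0 ∧ (p.1.2.1.1 : ℕ) = 0 ∧ p'.1.2.1.2 = p.1.2.1.2 ∧ p'.1.2.2 = p.1.2.2) then
      srcSmoothKernel M p.1.2.2 p'.1.1.1 p.1.1.1 else 0)
  else 0

omit [NeZero V] in
/-- Source rows of `S` against a general column. -/
theorem srcSmoothMat_apply_of_src (n : ℕ) (p' q' : SrcLabel V M n) (h1' : p'.2 = 1) (hq1 : q'.2 = 1) :
    srcSmoothMat V M n p' q' = if p'.1.1.2 = q'.1.1.2 ∧ p'.1.2 = q'.1.2 then srcSmoothKernel M p'.1.2.2 p'.1.1.1 q'.1.1.1 else 0 := by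
  rw [srcSmoothMat_apply, if_neg (show ¬(p'.2 = 0 ∧ q'.2 = 0) from fun h => absurd (h1'.symm.trans h.1) (by decide)),
    if_pos (show p'.2 = 1 ∧ q'.2 = 1 from ⟨h1', hq1⟩)]

/-- Source entries of `T⁺_k`. -/
theorem klSrcTransfer_apply_of_src (β μ : ℝ) (K : TrigPolyC4v) (k : ℕ) (q' : SrcLabel V M (k + 1)) (p : SrcLabel V M k) (hq1 : q'.2 = 1)
    (hp1 : p.2 = 1) :
    klSrcTransfer V M β μ K k q' p =
      if q'.1.1 = p.1.1 ∧ (q'.1.2.1.1 : ℕ) = 0 ∧ (p.1.2.1.1 : ℕ) = 0 ∧ q'.1.2.1.2 = p.1.2.1.2 ∧ q'.1.2.2 = p.1.2.2 then 1 else 0 := by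
  rw [klSrcTransfer_apply, if_neg (show ¬(q'.2 = 0 ∧ p.2 = 0) from fun h => absurd (hq1.symm.trans h.1) (by decide)),
    if_pos (show q'.2 = 1 ∧ p.2 = 1 from ⟨hq1, hp1⟩), klSlotShift_apply]

/-- Mixed entries of `T⁺_k` vanish. -/
theorem klSrcTransfer_apply_of_ne (β μ : ℝ) (K : TrigPolyC4v) (k : ℕ) (q' : SrcLabel V M (k + 1)) (p : SrcLabel V M k) (hne : q'.2 ≠ p.2) :
    klSrcTransfer V M β μ K k q' p = 0 := by
  rw [klSrcTransfer_apply, if_neg (show ¬(q'.2 = 0 ∧ p.2 = 0) from fun h => hne (h.1.trans h.2.symm)),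
    if_neg (show ¬(q'.2 = 1 ∧ p.2 = 1) from fun h => hne (h.1.trans h.2.symm))]

/-- `S_{k+1}·T⁺_k` in closed form. -/
theorem srcSmoothMat_mul_klSrcTransfer_apply (β μ : ℝ) (K : TrigPolyC4v) (k : ℕ) (p' : SrcLabel V M (k + 1)) (p : SrcLabel V M k) :
    (srcSmoothMat V M (k + 1) * klSrcTransfer V M β μ K k) p' p = transferSmoothForm β μ K k p' p := by
  classical
  rw [Matrix.mul_apply, transferSmoothForm]
  by_cases h' : p'.2 = 0
  · -- alive row: `S p' q' = [p' = q']`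
    simp_rw [srcSmoothMat_apply_of_alive p' _ h', ite_mul, one_mul, zero_mul]
    rw [Finset.sum_ite_eq univ p', if_pos (mem_univ _), klSrcTransfer_apply]
    have hn1 : ¬(p'.2 = 1 ∧ p.2 = 1) := fun h => absurd (h'.symm.trans h.1) (by decide)
    rw [if_neg hn1, if_neg hn1]
  · have h1' : p'.2 = 1 := fin_two_eq_one_of_ne_zero h'
    rw [if_neg (show ¬(p'.2 = 0 ∧ p.2 = 0) from fun h => h' h.1)]
    by_cases hp : p.2 = 1
    · rw [if_pos (show p'.2 = 1 ∧ p.2 = 1 from ⟨h1', hp⟩)]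
      -- the sum collapses at `q'₀ = ((p.1.1, p'.1.2), 1)`
      rw [Finset.sum_eq_single (((p.1.1, p'.1.2), 1) : SrcLabel V M (k + 1))]
      · rw [srcSmoothMat_apply_of_src (k + 1) p' _ h1' rfl, klSrcTransfer_apply_of_src β μ K k _ p rfl hp]
        dsimp only
        by_cases hx : p'.1.1.2 = p.1.1.2
        · by_cases hrest : (p'.1.2.1.1 : ℕ) = 0 ∧ (p.1.2.1.1 : ℕ) = 0 ∧ p'.1.2.1.2 = p.1.2.1.2 ∧ p'.1.2.2 = p.1.2.2
          · rw [if_pos (show p'.1.1.2 = p.1.1.2 ∧ p'.1.2 = p'.1.2 from ⟨hx, rfl⟩),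
              if_pos (show p.1.1 = p.1.1 ∧ (p'.1.2.1.1 : ℕ) = 0 ∧ (p.1.2.1.1 : ℕ) = 0 ∧ p'.1.2.1.2 = p.1.2.1.2 ∧ p'.1.2.2 = p.1.2.2 from ⟨rfl, hrest⟩),
              if_pos (show p'.1.1.2 = p.1.1.2 ∧ ((p'.1.2.1.1 : ℕ) = 0 ∧ (p.1.2.1.1 : ℕ) = 0 ∧ p'.1.2.1.2 = p.1.2.1.2 ∧ p'.1.2.2 = p.1.2.2) from ⟨hx, hrest⟩),
              mul_one, hrest.2.2.2]
          · rw [if_neg (show ¬(p.1.1 = p.1.1 ∧ (p'.1.2.1.1 : ℕ) = 0 ∧ (p.1.2.1.1 : ℕ) = 0 ∧ p'.1.2.1.2 = p.1.2.1.2 ∧ p'.1.2.2 = p.1.2.2) from fun h => hrest h.2),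
              if_neg (show ¬(p'.1.1.2 = p.1.1.2 ∧ ((p'.1.2.1.1 : ℕ) = 0 ∧ (p.1.2.1.1 : ℕ) = 0 ∧ p'.1.2.1.2 = p.1.2.1.2 ∧ p'.1.2.2 = p.1.2.2)) from fun h => hrest h.2),
              mul_zero]
        · rw [if_neg (show ¬(p'.1.1.2 = p.1.1.2 ∧ p'.1.2 = p'.1.2) from fun h => hx h.1),
            if_neg (show ¬(p'.1.1.2 = p.1.1.2 ∧ ((p'.1.2.1.1 : ℕ) = 0 ∧ (p.1.2.1.1 : ℕ) = 0 ∧ p'.1.2.1.2 = p.1.2.1.2 ∧ p'.1.2.2 = p.1.2.2)) from fun h => hx h.1),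
            zero_mul]
      · intro q' _ hq'
        by_cases hq1 : q'.2 = 1
        · rw [srcSmoothMat_apply_of_src (k + 1) p' q' h1' hq1, klSrcTransfer_apply_of_src β μ K k q' p hq1 hp]
          by_cases hmatch : p'.1.1.2 = q'.1.1.2 ∧ p'.1.2 = q'.1.2
          · by_cases hshift : q'.1.1 = p.1.1 ∧ (q'.1.2.1.1 : ℕ) = 0 ∧ (p.1.2.1.1 : ℕ) = 0 ∧ q'.1.2.1.2 = p.1.2.1.2 ∧ q'.1.2.2 = p.1.2.2
            · exfalso; apply hq'
              obtain ⟨⟨q11, q12⟩, q2⟩ := q'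
              simp only at hshift hmatch hq1 ⊢
              rw [hshift.1, ← hmatch.2, hq1]
            · rw [if_neg hshift, mul_zero]
          · rw [if_neg hmatch, zero_mul]
        · have hq0 : q'.2 = 0 := by by_contra h; exact hq1 (fin_two_eq_one_of_ne_zero h)
          rw [klSrcTransfer_apply_of_ne β μ K k q' p (by rw [hq0, hp]; decide), mul_zero]
      · intro h; exact absurd (mem_univ _) h
    · have hp0 : p.2 = 0 := by by_contra h; exact hp (fin_two_eq_one_of_ne_zero h)
      rw [if_neg (show ¬(p'.2 = 1 ∧ p.2 = 1) from fun h => hp h.2)]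
      refine Finset.sum_eq_zero fun q' _ => ?_
      by_cases hq0 : q'.2 = 0
      · obtain ⟨x', s'⟩ := p'
        obtain ⟨y, u⟩ := q'
        simp only at h1' hq0
        rw [srcSmoothMat_offDiag V M (k + 1) x' s' y u (by rw [h1', hq0]; decide), zero_mul]
      · rw [klSrcTransfer_apply_of_ne β μ K k q' p (by rw [hp0]; exact hq0), mul_zero]

/-- `T⁺_k·S_k` in closed form. -/
theorem klSrcTransfer_mul_srcSmoothMat_apply (β μ : ℝ) (K : TrigPolyC4v) (k : ℕ) (p' : SrcLabel V M (k + 1)) (p : SrcLabel V M k) :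
    (klSrcTransfer V M β μ K k * srcSmoothMat V M k) p' p = transferSmoothForm β μ K k p' p := by
  classical
  rw [Matrix.mul_apply, transferSmoothForm]
  by_cases hp : p.2 = 0
  · -- alive column: `S q p = [q = p]` for alive `q`, `0` for source `q`
    have hterm : ∀ q : SrcLabel V M k, klSrcTransfer V M β μ K k p' q * srcSmoothMat V M k q p =
        if q = p then klSrcTransfer V M β μ K k p' p else 0 := by
      intro q
      by_cases hq : q.2 = 0
      · rw [srcSmoothMat_apply_of_alive q p hq]
        by_cases hqp : q = p
        · subst hqp; rw [if_pos rfl, if_pos rfl, mul_one]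
        · rw [if_neg hqp, if_neg hqp, mul_zero]
      · have hqp : q ≠ p := fun h => hq (h ▸ hp)
        obtain ⟨y, u⟩ := q
        obtain ⟨x, s⟩ := p
        simp only at hq hp
        rw [if_neg hqp, srcSmoothMat_offDiag V M k y u x s (by rw [hp, fin_two_eq_one_of_ne_zero hq]; decide), mul_zero]
    rw [Fintype.sum_congr _ _ hterm, Fintype.sum_ite_eq', klSrcTransfer_apply]
    have hn1 : ¬(p'.2 = 1 ∧ p.2 = 1) := fun h => absurd (hp.symm.trans h.2) (by decide)
    rw [if_neg hn1, if_neg hn1]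
  · have hp1 : p.2 = 1 := fin_two_eq_one_of_ne_zero hp
    rw [if_neg (show ¬(p'.2 = 0 ∧ p.2 = 0) from fun h => hp h.2)]
    by_cases h' : p'.2 = 1
    · rw [if_pos (show p'.2 = 1 ∧ p.2 = 1 from ⟨h', hp1⟩)]
      -- the sum collapses at `q₀ = ((p'.1.1, p.1.2), 1)`
      rw [Finset.sum_eq_single (((p'.1.1, p.1.2), 1) : SrcLabel V M k)]
      · rw [klSrcTransfer_apply_of_src β μ K k p' _ h' rfl, srcSmoothMat_apply_of_src k _ p rfl hp1]
        dsimp only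
        by_cases hx : p'.1.1.2 = p.1.1.2
        · by_cases hrest : (p'.1.2.1.1 : ℕ) = 0 ∧ (p.1.2.1.1 : ℕ) = 0 ∧ p'.1.2.1.2 = p.1.2.1.2 ∧ p'.1.2.2 = p.1.2.2
          · rw [if_pos (show p'.1.1 = p'.1.1 ∧ (p'.1.2.1.1 : ℕ) = 0 ∧ (p.1.2.1.1 : ℕ) = 0 ∧ p'.1.2.1.2 = p.1.2.1.2 ∧ p'.1.2.2 = p.1.2.2 from ⟨rfl, hrest⟩),
              if_pos (show p'.1.1.2 = p.1.1.2 ∧ p.1.2 = p.1.2 from ⟨hx, rfl⟩),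
              if_pos (show p'.1.1.2 = p.1.1.2 ∧ ((p'.1.2.1.1 : ℕ) = 0 ∧ (p.1.2.1.1 : ℕ) = 0 ∧ p'.1.2.1.2 = p.1.2.1.2 ∧ p'.1.2.2 = p.1.2.2) from ⟨hx, hrest⟩),
              one_mul]
          · rw [if_neg (show ¬(p'.1.1 = p'.1.1 ∧ (p'.1.2.1.1 : ℕ) = 0 ∧ (p.1.2.1.1 : ℕ) = 0 ∧ p'.1.2.1.2 = p.1.2.1.2 ∧ p'.1.2.2 = p.1.2.2) from fun h => hrest h.2),
              if_neg (show ¬(p'.1.1.2 = p.1.1.2 ∧ ((p'.1.2.1.1 : ℕ) = 0 ∧ (p.1.2.1.1 : ℕ) = 0 ∧ p'.1.2.1.2 = p.1.2.1.2 ∧ p'.1.2.2 = p.1.2.2)) from fun h => hrest h.2),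
              zero_mul]
        · rw [if_neg (show ¬(p'.1.1.2 = p.1.1.2 ∧ p.1.2 = p.1.2) from fun h => hx h.1),
            if_neg (show ¬(p'.1.1.2 = p.1.1.2 ∧ ((p'.1.2.1.1 : ℕ) = 0 ∧ (p.1.2.1.1 : ℕ) = 0 ∧ p'.1.2.1.2 = p.1.2.1.2 ∧ p'.1.2.2 = p.1.2.2)) from fun h => hx h.1),
            mul_zero]
      · intro q _ hq
        by_cases hq1 : q.2 = 1
        · rw [klSrcTransfer_apply_of_src β μ K k p' q h' hq1, srcSmoothMat_apply_of_src k q p hq1 hp1]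
          by_cases hshift : p'.1.1 = q.1.1 ∧ (p'.1.2.1.1 : ℕ) = 0 ∧ (q.1.2.1.1 : ℕ) = 0 ∧ p'.1.2.1.2 = q.1.2.1.2 ∧ p'.1.2.2 = q.1.2.2
          · by_cases hmatch : q.1.1.2 = p.1.1.2 ∧ q.1.2 = p.1.2
            · exfalso; apply hq
              obtain ⟨⟨q11, q12⟩, q2⟩ := q
              simp only at hshift hmatch hq1 ⊢
              rw [← hshift.1, hmatch.2, hq1]
            · rw [if_neg hmatch, mul_zero]
          · rw [if_neg hshift, zero_mul]
        · have hq0 : q.2 = 0 := by by_contra h; exact hq1 (fin_two_eq_one_of_ne_zero h)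
          rw [klSrcTransfer_apply_of_ne β μ K k p' q (by rw [h', hq0]; decide), zero_mul]
      · intro h; exact absurd (mem_univ _) h
    · have h0' : p'.2 = 0 := by by_contra h; exact h' (fin_two_eq_one_of_ne_zero h)
      rw [if_neg (show ¬(p'.2 = 1 ∧ p.2 = 1) from fun h => h' h.1)]
      refine Finset.sum_eq_zero fun q _ => ?_
      by_cases hq0 : q.2 = 0
      · obtain ⟨y, u⟩ := q
        obtain ⟨x, s⟩ := p
        simp only at hq0 hp1
        rw [srcSmoothMat_offDiag V M k y u x s (by rw [hq0, hp1]; decide), mul_zero]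
      · rw [klSrcTransfer_apply_of_ne β μ K k p' q (by rw [h0']; exact Ne.symm hq0), zero_mul]

/-- **The smoothing intertwines the doubled transfers**: `S_{k+1} · T⁺_k = T⁺_k · S_k` (the re-analysis acts on the alive copy where `S = 𝟙`; the slot shift is
diagonal in space-time, spin and charge, the smoothing is diagonal in site, slot, spin and charge and acts on time only). [cite: Salmhofer1999, App. B.2 (B.23)-(B.25)] -/
theorem srcSmoothMat_mul_klSrcTransfer (β μ : ℝ) (K : TrigPolyC4v) (k : ℕ) :
    srcSmoothMat V M (k + 1) * klSrcTransfer V M β μ K k = klSrcTransfer V M β μ K k * srcSmoothMat V M k := by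
  ext p' p
  rw [srcSmoothMat_mul_klSrcTransfer_apply, klSrcTransfer_mul_srcSmoothMat_apply]

/-- **The doubled transfer commutes with the smoothing on the algebra**: `map T⁺_k (srcSmooth_k X) = srcSmooth_{k+1} (map T⁺_k X)`.
[cite: Salmhofer1999, App. B.2 (B.23)-(B.25)] -/
theorem map_klSrcTransfer_srcSmooth_comm (β μ : ℝ) (K : TrigPolyC4v) (k : ℕ) (X : GrassmannAlgebra ℂ (SrcLabel V M k)) :
    ExteriorAlgebra.map (Matrix.toLin' (klSrcTransfer V M β μ K k)) (srcSmooth V M k X) =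
      srcSmooth V M (k + 1) (ExteriorAlgebra.map (Matrix.toLin' (klSrcTransfer V M β μ K k)) X) := by
  rw [srcSmooth_apply, srcSmooth_apply, ← AlgHom.comp_apply, ExteriorAlgebra.map_comp_map, ← Matrix.toLin'_mul,
    ← srcSmoothMat_mul_klSrcTransfer, Matrix.toLin'_mul, ← ExteriorAlgebra.map_comp_map, AlgHom.comp_apply]

end Transfer

/-! ## §5 Commutation with the source rescaling -/

section Scale

open Summit.HubbardSuperconductivity.HubbardSuperconductivity.Theorems.TwoVolumeDefect

variable {V M : ℕ} [NeZero V]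

/-- **The smoothing commutes with the source rescaling `srcScale t`** (both act on copy `1`; the smoothing is copy-diagonal — g15's `map_toLin'_srcScale_comm`).
[cite: BenfattoGiulianiMastropietro2006, §2.9 (4.6)-(4.8)] -/
theorem srcSmooth_srcScale_comm (n : ℕ) (t : ℝ) (X : GrassmannAlgebra ℂ (SrcLabel V M n)) :
    srcSmooth V M n (srcScale ℂ t X) = srcScale ℂ t (srcSmooth V M n X) := by
  rw [srcSmooth_apply, srcSmooth_apply]
  exact map_toLin'_srcScale_comm (srcSmoothMat V M n) (srcSmoothMat_offDiag V M n) t X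

end Scale

end Summit.HubbardSuperconductivity.HubbardSuperconductivity.Theorems.TwoVolumeSource

end
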